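import Summits.CriticalPhenomena.SAWScalingLimit.Theorems.SAWDevelopingMapNoFoldBoundDepthTwoPort
import Summits.CriticalPhenomena.SAWScalingLimit.Theorems.SAWDevelopingMapNoFoldBoundLoopWinding

/-!
# The middle port of a depth-two vertex carries no slit loop

Helper file for the crux `NoFoldBound` (stmt-CriticalPhenomena-8296) of the route
`SAWDevelopingMap` (sub-problem `SAWScalingLimit` of `CriticalPhenomena`), line `Ideator3Sketch`,
stub `middle_port_no_slit_loop`.

Setting (Duminil-Copin–Smirnov 2012, §2): a finite vertex set `Λ` of the hexagonal lattice `ℍ`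
with connected complement (`hexDomainSimplyConnected`), a source mid-edge `a ∈ ∂Ω`
(`hexDomainBoundary`), a vertex `v ∈ Λ` off `a` with its three neighbours `w₀, w₁, w₂` in the
positive order (the one-step turn `w₀ → v → w₁` is `+π/3`), where `w₀ ∈ Λ` touches the complement:
`w₀ ∼ x ∉ Λ` (`x ≠ v`), third neighbour `y`.  In the depth-two reduction (`depthTwo_core`) the
dressed mass of a port `w` involves, for every first arrival `γ` at `w` (a walk from `a` to the
mid-edge `{v, w}` avoiding `v`), the sum over the SLIT LOOPS of `γ`: the self-avoiding walks of the
slit domain `(Λ ∖ γ) ∖ {v}` between the mid-edges of the two OTHER ports.  We prove that at the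
MIDDLE port (`w₁` if `y → w₀ → v` turns left, `w₂` if it turns right) there is no slit loop at all
(`middle_port_no_slit_loop`), so that its dressed masses are the bare ones.

## Proof (discrete Jordan, via the loop lemma)

Let `m` be the middle port, `γ` a first arrival at `m` (it ends at `m`), and suppose `δ` is a walk
of `(Λ ∖ γ) ∖ {v}` between the mid-edges `{v, q}` and `{v, w₀}` of the two other ports; orient it
from `q` to `w₀` and close it up through `v`: in a chart `Φ : hexGraph ≃g hvGraph`
(`HV.exists_chart`) the list `c = Φ v, Φ q, …, Φ w₀` is a simple cycle of `Φ(Λ ∖ γ)`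
(`turn_eq_turn_of_slitPath`).  Two vertices adjacent to the cycle are OUTSIDE it, i.e. the faces
at them have winding number `0` (`wnd_rightFace_eq_zero_of_simplyConnected`, "joined off the
domain to infinity"):
* `x ∉ Λ`, adjacent to the cycle vertex `w₀`, because `Λ` has a connected complement;
* the middle port `m ∈ γ`, adjacent to the cycle vertex `v`, because the slit domain `Λ ∖ γ` has a
  connected complement as well (`stub_slitSC`: `γ` is a chain attached to the outer endpoint of the
  source mid-edge) and `m ∉ Λ ∖ γ`.
The loop lemma `HV.cturn_eq_neg_six_mul_turn` at `v` (seen from `m`) gives the turning number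
`cturn c = -6 · turn (Φ m) (Φ v) (Φ q)`, and at `w₀` (seen from `x`, after rotating the cycle to
`Φ w₀, Φ v, Φ q, …`) `cturn c = -6 · turn (Φ x) (Φ w₀) (Φ v)`; hence
`turn (Φ m) (Φ v) (Φ q) = turn (Φ x) (Φ w₀) (Φ v)`.  But the hypotheses pin both turns with
OPPOSITE signs: the positive labelling gives `turn w₀ v w₁ = turn w₁ v w₂ = +1`
(`HV.turn_eq_neg_turn`, `HV.turn_eq_neg_turn'`), i.e. `turn m v q = +1` in the left case
(`m = w₁`, `q = w₂`) and `-1` in the right case (`m = w₂`, `q = w₁`, `HV.turn_rev`), while the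
chirality `turn y w₀ v = ±1` gives `turn x w₀ v = ∓1`.  Contradiction, so no `δ` exists.
-/

noncomputable section

open Literature.Probability.LatticeModels Literature.Probability.RandomPlanarGeometry.SAW

namespace Summit.CriticalPhenomena.SAWScalingLimit.Theorems.SAWDevelopingMapNoFoldBound

open Literature.Probability.RandomPlanarGeometry.SAW.HV
open Summit.CriticalPhenomena.SAWScalingLimit.Theorems.SourceLoopBound

variable {Λ : Finset HexVertex} {a : Sym2 HexVertex} {v m q w₀ x : HexVertex}

/-! ### From one-step windings to lattice turns -/

/-- If `(π/3) · t = π/3` for an integer `t`, then `t = 1`. -/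
theorem int_eq_one_of_pi_div_three_mul {t : ℤ} (h : Real.pi / 3 * (t : ℝ) = Real.pi / 3) :
    t = 1 := by
  have hπ : (Real.pi / 3 : ℝ) ≠ 0 := by positivity
  have ht : (t : ℝ) = 1 := mul_left_cancel₀ hπ (by rw [h, mul_one])
  exact_mod_cast ht

/-- If `(π/3) · t = -π/3` for an integer `t`, then `t = -1`. -/
theorem int_eq_neg_one_of_pi_div_three_mul {t : ℤ} (h : Real.pi / 3 * (t : ℝ) = -(Real.pi / 3)) :
    t = -1 := by
  have hπ : (Real.pi / 3 : ℝ) ≠ 0 := by positivity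
  have ht : (t : ℝ) = -1 := mul_left_cancel₀ hπ (by rw [h, mul_neg_one])
  exact_mod_cast ht

/-! ### A slit path between two ports, closed up through `v`: the two outside turns agree -/

/-- **The cycle lemma behind `middle_port_no_slit_loop`.** Let `Λ` have a connected complement,
`a ∈ ∂Ω`, `v ∈ Λ` off `a` with neighbours `m, q, w₀` (`q ≠ w₀`), `w₀ ∼ x ∉ Λ` (`x ≠ v`), and let
`γ` be a first arrival at `v` through the port `m` (a walk from `a` to `{v, m}` avoiding `v`; it
ends at `m`).  If `P` is a self-avoiding lattice path of `(Λ ∖ γ) ∖ {v}` from `q` to `w₀`, then for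
every chart `Φ : hexGraph ≃g hvGraph`, `turn (Φ m) (Φ v) (Φ q) = turn (Φ x) (Φ w₀) (Φ v)`: the
closed-up path `Φ v, Φ(P)` is a simple cycle of `Φ(Λ ∖ γ)`; the vertex `m ∈ γ` off it is outside
(the slit domain `Λ ∖ γ` has a connected complement, `stub_slitSC`), so the loop lemma at `v` gives
`cturn = -6 · turn (Φ m) (Φ v) (Φ q)`; the vertex `x ∉ Λ` off it is outside (`Λ` has a connected
complement), so the loop lemma at `w₀` (on the rotated cycle `Φ w₀, Φ v, …`) gives
`cturn = -6 · turn (Φ x) (Φ w₀) (Φ v)`. -/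
theorem turn_eq_turn_of_slitPath (hΛ : hexDomainSimplyConnected Λ) (ha : a ∈ hexDomainBoundary Λ)
    (hv : v ∈ Λ) (hva : v ∉ a) (hvm : hexGraph.Adj v m) (hvq : hexGraph.Adj v q)
    (hvw : hexGraph.Adj v w₀) (hqw : q ≠ w₀) (hwx : hexGraph.Adj w₀ x) (hvx : v ≠ x)
    (hx : x ∉ Λ) (γ : HexMidEdgeSAW Λ a s(v, m)) (hvγ : v ∉ γ.verts) {P : List HexVertex}
    (hP : ∀ z ∈ P, z ∈ (Λ \ γ.verts.toFinset).erase v) (hPnd : P.Nodup)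
    (hPch : P.IsChain hexGraph.Adj) (hPne : P ≠ []) (hPh : P.head hPne = q)
    (hPl : P.getLast hPne = w₀) (Φ : hexGraph ≃g hvGraph) :
    turn (Φ m) (Φ v) (Φ q) = turn (Φ x) (Φ w₀) (Φ v) := by
  -- membership along `P`: in `Λ`, off `γ`, off `v`
  have hP' : ∀ z ∈ P, z ∈ Λ ∧ z ∉ γ.verts ∧ z ≠ v := fun z hz => by
    have h := hP z hz
    simp only [Finset.mem_erase, Finset.mem_sdiff, List.mem_toFinset] at h
    exact ⟨h.2.1, h.2.2, h.1⟩
  -- `m` is the last vertex of `γ`, hence on `γ`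
  have hmγ : m ∈ γ.verts := List.mem_of_getLast? (arrival_getLast?_eq hva γ hvγ)
  -- `P = q' :: rest` with `q' = q` and `rest ≠ []`
  obtain ⟨q', rest, rfl⟩ : ∃ q' rest, P = q' :: rest := List.exists_cons_of_ne_nil hPne
  have hq' : q' = q := by simpa using hPh
  have hvq' : hexGraph.Adj v q' := by rw [hq']; exact hvq
  have hrest : rest ≠ [] := by
    rintro rfl
    have h : q' = w₀ := by simpa using hPl
    exact hqw (hq'.symm.trans h)
  -- adjacencies in the model
  have amv : hvGraph.Adj (Φ m) (Φ v) := (Φ.map_rel_iff).2 hvm.symm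
  have avm : hvGraph.Adj (Φ v) (Φ m) := (Φ.map_rel_iff).2 hvm
  have awv : hvGraph.Adj (Φ w₀) (Φ v) := (Φ.map_rel_iff).2 hvw.symm
  have awx : hvGraph.Adj (Φ w₀) (Φ x) := (Φ.map_rel_iff).2 hwx
  have axw : hvGraph.Adj (Φ x) (Φ w₀) := (Φ.map_rel_iff).2 hwx.symm
  -- Step 1: the closed-up path `Φ v :: Φ q' :: Φ(rest)` is a simple cycle ending at `Φ w₀`
  set R : List HV := rest.map Φ with hR
  have hRne : R ≠ [] := by simpa [hR] using hrest
  have hcode : (v :: q' :: rest).map Φ = Φ v :: Φ q' :: R := by simp [hR]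
  have hmem : ∀ z ∈ Φ v :: Φ q' :: R, ∃ t ∈ v :: q' :: rest, Φ t = z := fun z hz => by
    rw [← hcode, List.mem_map] at hz
    exact hz
  have hg : (Φ v :: Φ q' :: R).getLast (List.cons_ne_nil _ _) = Φ w₀ := by
    have h1 : ((v :: q' :: rest).map Φ).getLast (by simp) = Φ w₀ := by
      rw [List.getLast_map, List.getLast_cons (List.cons_ne_nil _ _), hPl]
    simpa only [hcode] using h1
  have hcyc : IsCyc (Φ v :: Φ q' :: R) := by
    refine ⟨?_, ?_, fun d hd => ?_⟩
    · have := List.length_pos_of_ne_nil hRne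
      simp only [List.length_cons]
      omega
    · rw [← hcode]
      exact (List.Nodup.cons (fun hvP => (hP' v hvP).2.2 rfl) hPnd).map Φ.injective
    · rw [cdarts_eq (List.cons_ne_nil _ _), List.mem_append, List.mem_singleton] at hd
      rcases hd with hd | rfl
      · have hch : ((v :: q' :: rest).map Φ).IsChain hvGraph.Adj := by
          rw [List.isChain_map]
          exact List.IsChain.imp (fun p q h => (Φ.map_rel_iff).2 h)
            (List.IsChain.cons_cons hvq' hPch)
        rw [hcode] at hch
        exact adj_of_mem_pdarts hch d hd
      · rw [hg, List.head_cons]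
        exact awv
  -- its vertices lie in `Λ ∖ γ`, in particular in `Λ`
  have hcΛ' : ∀ z ∈ Φ v :: Φ q' :: R, ∃ t ∈ Λ \ γ.verts.toFinset, Φ t = z := fun z hz => by
    obtain ⟨t, ht, rfl⟩ := hmem z hz
    refine ⟨t, ?_, rfl⟩
    rw [Finset.mem_sdiff, List.mem_toFinset]
    rcases List.mem_cons.1 ht with rfl | ht
    · exact ⟨hv, hvγ⟩
    · exact ⟨(hP' t ht).1, (hP' t ht).2.1⟩
  have hcΛ : ∀ z ∈ Φ v :: Φ q' :: R, ∃ t ∈ Λ, Φ t = z := fun z hz => by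
    obtain ⟨t, ht, rfl⟩ := hcΛ' z hz
    exact ⟨t, (Finset.mem_sdiff.1 ht).1, rfl⟩
  -- Step 2: the port `m` is off the cycle and outside it (the slit domain `Λ ∖ γ` has a connected
  -- complement and `m ∈ γ`), so the loop lemma at `v` seen from `m` applies
  have hmn : Φ m ∉ Φ v :: Φ q' :: R := fun h => by
    obtain ⟨t, ht, htm⟩ := hmem _ h
    have htm' : t = m := Φ.injective htm
    subst htm'
    rcases List.mem_cons.1 ht with h' | h'
    · exact hvm.ne h'.symm
    · exact (hP' _ h').2.1 hmγ
  have h0v : wnd (Φ v :: Φ q' :: R) (leftFace (Φ v) (Φ m)) = 0 :=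
    wnd_rightFace_eq_zero_of_simplyConnected (stub_slitSC Λ hΛ a ha _ γ)
      (fun h => (Finset.mem_sdiff.1 h).2 (List.mem_toFinset.2 hmγ)) Φ hcΛ' hcyc.2.2 amv
  have key₁ := cturn_eq_neg_six_mul_turn hcyc (List.cons_ne_nil _ _) avm hmn h0v
  simp only [List.head_cons] at key₁
  -- Step 3: rotate the cycle to start at `w₀`: `Φ w₀ :: Φ v :: Φ(init)`, `q' :: rest = init ++ [w₀]`
  obtain ⟨init, hsplit⟩ : ∃ init : List HexVertex, q' :: rest = init ++ [w₀] :=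
    ⟨(q' :: rest).dropLast, by rw [← hPl, List.dropLast_append_getLast]⟩
  have e : Φ v :: Φ q' :: R = (Φ v :: init.map Φ) ++ [Φ w₀] := by
    rw [← hcode, hsplit]
    simp
  have hrot : (Φ v :: Φ q' :: R).rotate (Φ v :: init.map Φ).length =
      Φ w₀ :: Φ v :: init.map Φ := by
    rw [e, List.rotate_append_length_eq]
    rfl
  have hcyc' : IsCyc (Φ w₀ :: Φ v :: init.map Φ) := by
    rw [← hrot]
    exact hcyc.rotate _
  have hct : cturn (Φ w₀ :: Φ v :: init.map Φ) = cturn (Φ v :: Φ q' :: R) := by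
    rw [← hrot, cturn_rotate hcyc.1]
  have hwnd : ∀ F, wnd (Φ w₀ :: Φ v :: init.map Φ) F = wnd (Φ v :: Φ q' :: R) F := fun F => by
    rw [← hrot, wnd_rotate]
  have hmem' : ∀ z ∈ Φ w₀ :: Φ v :: init.map Φ, z ∈ Φ v :: Φ q' :: R := fun z hz => by
    rw [← hrot, List.mem_rotate] at hz
    exact hz
  -- Step 4: the outer vertex `x ∉ Λ` is off the cycle and outside it (`Λ` has a connected
  -- complement), so the loop lemma at `w₀` seen from `x` applies
  have hxn : Φ x ∉ Φ w₀ :: Φ v :: init.map Φ := fun h => by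
    obtain ⟨t, ht, htx⟩ := hcΛ _ (hmem' _ h)
    exact hx ((Φ.injective htx) ▸ ht)
  have h0w : wnd (Φ w₀ :: Φ v :: init.map Φ) (leftFace (Φ w₀) (Φ x)) = 0 := by
    rw [hwnd]
    exact wnd_rightFace_eq_zero_of_simplyConnected hΛ hx Φ hcΛ hcyc.2.2 axw
  have key₂ := cturn_eq_neg_six_mul_turn hcyc' (List.cons_ne_nil _ _) awx hxn h0w
  simp only [List.head_cons] at key₂
  -- Step 5: compare the two evaluations of the turning number
  rw [← hq']
  omega

/-! ### The statement -/

/-- **The middle port carries no slit loop** (depth-2 vertex). Let `Λ` be simply connected with source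
`a ∈ ∂Ω`, `v ∈ Λ` off `a` with neighbours `w₀, w₁, w₂` in the positive order (turn `w₀ → v → w₁ = +π/3`),
`w₀ ∈ Λ` off `a` touching the complement (`w₀ ∼ x ∉ Λ`, third neighbour `y`). If `y → w₀ → v` turns LEFT (so
the middle port is `w₁`, `depthTwo_core`), then for every first arrival `γ` at the port `w₁` there is NO
self-avoiding walk of the slit domain `(Λ ∖ γ) ∖ {v}` from the mid-edge `{v, w₂}` to the mid-edge `{v, w₀}`;
if it turns RIGHT (middle port `w₂`), the same holds for first arrivals at `w₂` and walks from `{v, w₀}` to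
`{v, w₁}`. Reason (Jordan): such a walk `δ` closed up through `v` is a simple cycle of `Λ` avoiding `γ`; at `v`
and at `w₀` it turns in opposite senses, so the unused edges `v–w_mid` and `w₀–x` lie on opposite sides; `x` is
outside (joined to infinity off `Λ`), hence `w_mid` is inside — but `γ` joins `w_mid` to the source vertex, which
is adjacent to the complement, without meeting the cycle. Consequence: the dressed masses of the middle port are
`α_T N_mid`, `β_T N_mid` exactly (the loop sums in `stub_portDominance` vanish at the middle port). -/
theorem middle_port_no_slit_loop :
    ∀ (Λ : Finset HexVertex), hexDomainSimplyConnected Λ → ∀ a ∈ hexDomainBoundary Λ,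
      ∀ v ∈ Λ, v ∉ a → ∀ w₀ w₁ w₂ x y : HexVertex, hexGraph.Adj v w₀ → hexGraph.Adj v w₁ →
      hexGraph.Adj v w₂ → w₀ ≠ w₁ → w₁ ≠ w₂ → w₀ ≠ w₂ → w₀ ∈ Λ → w₀ ∉ a →
      winding [hexMidpoint s(w₀, v), hexCenter v, hexMidpoint s(v, w₁)] = Real.pi / 3 →
      hexGraph.Adj w₀ x → hexGraph.Adj w₀ y → v ≠ x → x ≠ y → v ≠ y → x ∉ Λ →
      (winding [hexMidpoint s(y, w₀), hexCenter w₀, hexMidpoint s(w₀, v)] = Real.pi / 3 →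
          ∀ γ : HexMidEdgeSAW Λ a s(v, w₁), v ∉ γ.verts →
            IsEmpty (HexMidEdgeSAW ((Λ \ γ.verts.toFinset).erase v) s(v, w₂) s(v, w₀))) ∧
        (winding [hexMidpoint s(y, w₀), hexCenter w₀, hexMidpoint s(w₀, v)] = -(Real.pi / 3) →
          ∀ γ : HexMidEdgeSAW Λ a s(v, w₂), v ∉ γ.verts →
            IsEmpty (HexMidEdgeSAW ((Λ \ γ.verts.toFinset).erase v) s(v, w₀) s(v, w₁))) := by
  intro Λ hΛ a ha v hv hva w₀ w₁ w₂ x y h₀ h₁ h₂ h01 h12 h02 _ _ H1 hwx hwy hvx hxy hvy hx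
  -- a chart; adjacencies and distinctness in the model
  obtain ⟨Φ, α, β, hα, -, -, haff⟩ := exists_chart h₀
  have a0 : hvGraph.Adj (Φ v) (Φ w₀) := (Φ.map_rel_iff).2 h₀
  have a1 : hvGraph.Adj (Φ v) (Φ w₁) := (Φ.map_rel_iff).2 h₁
  have a2 : hvGraph.Adj (Φ v) (Φ w₂) := (Φ.map_rel_iff).2 h₂
  have b0 : hvGraph.Adj (Φ w₀) (Φ v) := (Φ.map_rel_iff).2 h₀.symm
  have bx : hvGraph.Adj (Φ w₀) (Φ x) := (Φ.map_rel_iff).2 hwx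
  have bY : hvGraph.Adj (Φ w₀) (Φ y) := (Φ.map_rel_iff).2 hwy
  have n01 : Φ w₀ ≠ Φ w₁ := Φ.injective.ne h01
  have n12 : Φ w₁ ≠ Φ w₂ := Φ.injective.ne h12
  have n02 : Φ w₀ ≠ Φ w₂ := Φ.injective.ne h02
  have nvx : Φ v ≠ Φ x := Φ.injective.ne hvx
  have nxy : Φ x ≠ Φ y := Φ.injective.ne hxy
  have nvy : Φ v ≠ Φ y := Φ.injective.ne hvy
  -- positive labelling: `turn w₀ v w₁ = +1`, hence `turn w₁ v w₂ = +1` (trivalent vertex `v`)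
  have t01 : turn (Φ w₀) (Φ v) (Φ w₁) = 1 :=
    int_eq_one_of_pi_div_three_mul ((winding_midpoints_eq_turn h₀ h₁ h01 haff hα).symm.trans H1)
  have e1 : turn (Φ w₁) (Φ v) (Φ w₂) = -turn (Φ w₀) (Φ v) (Φ w₂) :=
    turn_eq_neg_turn a0 a2 a1 n02 n12.symm n01
  have e2 : turn (Φ w₀) (Φ v) (Φ w₂) = -turn (Φ w₀) (Φ v) (Φ w₁) :=
    turn_eq_neg_turn' a0 a1 a2 n01 n12 n02
  -- at `w₀`: the turn `x → w₀ → v` is opposite to the chirality turn `y → w₀ → v`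
  have txy : turn (Φ x) (Φ w₀) (Φ v) = -turn (Φ y) (Φ w₀) (Φ v) :=
    turn_eq_neg_turn bY b0 bx nvy.symm nvx nxy.symm
  refine ⟨fun hl γ hvγ => ⟨fun δ => ?_⟩, fun hr γ hvγ => ⟨fun δ => ?_⟩⟩
  · -- LEFT chirality, middle port `w₁`; `δ` runs `w₂ → ⋯ → w₀` in `(Λ ∖ γ) ∖ {v}`
    have ty : turn (Φ y) (Φ w₀) (Φ v) = 1 :=
      int_eq_one_of_pi_div_three_mul
        ((winding_midpoints_eq_turn hwy h₀.symm hvy.symm haff hα).symm.trans hl)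
    have hne : δ.verts ≠ [] := loop_verts_ne_nil h₀ h02 δ
    obtain ⟨rest, hrest⟩ := loop_head_eq h₀ h02 δ
    have hvδ : v ∉ δ.verts := fun h => (Finset.mem_erase.1 (δ.subset v h)).1 rfl
    have hlast : δ.verts.getLast hne = w₀ := by
      rcases δ.getLast_eq_or hne with h | h
      · exact absurd h (ne_of_mem_of_not_mem (List.getLast_mem hne) hvδ)
      · exact h
    have hhead : δ.verts.head hne = w₂ := by simp [hrest]
    have key := turn_eq_turn_of_slitPath hΛ ha hv hva h₁ h₂ h₀ h02.symm hwx hvx hx γ hvγ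
      δ.subset δ.nodup δ.isChain hne hhead hlast Φ
    omega
  · -- RIGHT chirality, middle port `w₂`; `δ` runs `w₀ → ⋯ → w₁` in `(Λ ∖ γ) ∖ {v}`: reverse it
    have ty : turn (Φ y) (Φ w₀) (Φ v) = -1 :=
      int_eq_neg_one_of_pi_div_three_mul
        ((winding_midpoints_eq_turn hwy h₀.symm hvy.symm haff hα).symm.trans hr)
    have hne : δ.verts ≠ [] := loop_verts_ne_nil h₁ h01.symm δ
    obtain ⟨rest, hrest⟩ := loop_head_eq h₁ h01.symm δ
    have hvδ : v ∉ δ.verts := fun h => (Finset.mem_erase.1 (δ.subset v h)).1 rfl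
    have hlast : δ.verts.getLast hne = w₁ := by
      rcases δ.getLast_eq_or hne with h | h
      · exact absurd h (ne_of_mem_of_not_mem (List.getLast_mem hne) hvδ)
      · exact h
    have hne' : δ.verts.reverse ≠ [] := by simpa using hne
    have hhead' : δ.verts.reverse.head hne' = w₁ := by rw [List.head_reverse, hlast]
    have hlast' : δ.verts.reverse.getLast hne' = w₀ := by
      rw [List.getLast_reverse]
      simp [hrest]
    have key := turn_eq_turn_of_slitPath hΛ ha hv hva h₂ h₁ h₀ h01.symm hwx hvx hx γ hvγ
      (fun z hz => δ.subset z (List.mem_reverse.1 hz)) (List.nodup_reverse.2 δ.nodup)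
      (List.isChain_reverse.2 (δ.isChain.imp fun _ _ h => h.symm)) hne' hhead' hlast' Φ
    have hrev := turn_rev (Φ w₁) (Φ v) (Φ w₂)
    omega

end Summit.CriticalPhenomena.SAWScalingLimit.Theorems.SAWDevelopingMapNoFoldBound

end
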